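import Literature.Analysis.FluidPDE.ElgindiAngularCorrector
import HarnessLib

/-!
# The angular corrector of Elgindi's profile: orthogonality, boundary values, and the differential
equation ([Elgindi2021] §8.3 Proposition 8.13; [ElgindiGhoulMasmoudi2021] §2.3.1)

Topic `Literature/Analysis/FluidPDE`. Support file (definitions with bodies and proved theorems, no
named facts) on the proof path of the named fact
`Literature.Analysis.FluidPDE.Elgindi.ElgindiGhoulMasmoudi2021_stabilityCore`
(`ElgindiStabilityDecomposition.lean`). T. M. Elgindi, Ann. of Math. 194 (2021) =
arXiv:1904.04795, §8.3 Proposition 8.13 (p. 27); Elgindi–Ghoul–Masmoudi, arXiv:1910.14071,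
§2.3.1 (p. 8–9).

For the corrector `χ₁` of `ElgindiAngularCorrector.lean` (fixed point of
`χ ↦ 𝒦(Γ̄ − μ₁cos θ·χ) − c·sin θ`, `0 < α ≤ 1/200`) and `ψ₁ = cos θ·χ₁` this file proves:
* **orthogonality** `∫₀^{π/2} ψ₁ sin θ cos²θ dθ = 0` (`integral_psiOne_mul_K0`; `∫sin²cos³ = 2/15`);
* **boundary values** `χ₁(0) = 0` (from `⟨Γ̄, K₀⟩ = 0`, `integral_K0_mul_gammaBar`), hence
  `ψ₁(0) = ψ₁(π/2) = 0`;
* **the derivative** `χ₁′ = cos θ·I₁ + (v₂/cos³θ)I₂ − c₁cos θ` on `(0, π/2)` (`hasDerivAt_chiOne`) and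
  the **flux equation** `(cos³θχ₁′)′ = −(4 − μ₁)cos³θχ₁ − cos²θΓ̄` (`hasDerivAt_chiOne_flux`), i.e.
  `Mχ₁ − μ₁χ₁ = Γ̄/cos θ`; the second derivative `χ₁″ = 3 tan θ χ₁′ − (4−μ₁)χ₁ − Γ̄/cos θ`;
* **the equation for `ψ₁` in the form of the angular operator**:
  `ψ₁′ = −sin θχ₁ + cos θχ₁′`, `ψ₁″ = sin θχ₁′ − (5−μ₁)cos θχ₁ − Γ̄` (bounded!),
  `(tan θ·ψ₁)′ = cos θχ₁ + sin θχ₁′`, and `−ψ₁″ + (tan θψ₁)′ − 6ψ₁ = Γ̄ − μ₁ψ₁`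
  (`angularOp_psiOne`), i.e. `(L_θ + μ₁)ψ₁ = Γ̄`;
* **sup bounds** `|χ₁| ≤ 300`, `|cos θ·χ₁′| ≤ 300`, `|ψ₁′| ≤ 600`, `|ψ₁″| ≤ 2410` on `(0, π/2)`.
-/

noncomputable section

open Set Real Filter MeasureTheory intervalIntegral BoundedContinuousFunction
open _root_.Topology

namespace Literature.Analysis.FluidPDE

namespace Elgindi

/-! ### Two trigonometric integrals -/

/-- `∫₀^{π/2} cos β sin β·(sin β cos²β) dβ = 2/15`. [folklore] -/
theorem integral_cos_sin_mul_K0 : ∫ β in (0:ℝ)..(π / 2), Real.cos β * Real.sin β * (Real.sin β * Real.cos β ^ 2) = 2 / 15 := by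
  have hd : ∀ x ∈ uIcc (0:ℝ) (π / 2), HasDerivAt (fun β => Real.sin β ^ 3 / 3 - Real.sin β ^ 5 / 5)
      (Real.cos x * Real.sin x * (Real.sin x * Real.cos x ^ 2)) x := by
    intro x _
    have hs := Real.hasDerivAt_sin x
    have h := ((hs.fun_pow 3).div_const 3).fun_sub ((hs.fun_pow 5).div_const 5)
    refine h.congr_deriv ?_
    have hs2 : Real.sin x ^ 2 + Real.cos x ^ 2 = 1 := Real.sin_sq_add_cos_sq x
    push_cast
    linear_combination (-(Real.cos x * Real.sin x ^ 2)) * hs2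
  rw [integral_eq_sub_of_hasDerivAt hd (by apply Continuous.intervalIntegrable; fun_prop), Real.sin_pi_div_two, Real.sin_zero]
  norm_num

/-- `∫₀^{π/2} (sin β cos²β)·sin 2β dβ = 4/15`. [folklore] -/
theorem integral_K0_mul_sin_two_mul : ∫ β in (0:ℝ)..(π / 2), Real.sin β * Real.cos β ^ 2 * Real.sin (2 * β) = 4 / 15 := by
  have e : (fun β => Real.sin β * Real.cos β ^ 2 * Real.sin (2 * β)) = fun β => 2 * (Real.cos β * Real.sin β * (Real.sin β * Real.cos β ^ 2)) := by
    funext β; rw [Real.sin_two_mul]; ring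
  rw [e, intervalIntegral.integral_const_mul, integral_cos_sin_mul_K0]; norm_num

/-- **`⟨Γ̄, K₀⟩ = 0`**: `∫₀^{π/2} sin β cos²β·Γ̄(β) dβ = 0` (`∫K₀Γ = c/3`, `∫K₀ sin 2β = 4/15`). [cite: Elgindi2021, §8.3 proof of Proposition 8.13 (p. 27 of arXiv:1904.04795): "so that ∫₀^{π/2} F̄_* K = 0"] -/
theorem integral_K0_mul_gammaBar {α : ℝ} (hα : 0 ≤ α) :
    ∫ β in (0:ℝ)..(π / 2), Real.sin β * Real.cos β ^ 2 * gammaBar α β = 0 := by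
  have h1 : ∫ β in (0:ℝ)..(π / 2), Real.sin β * Real.cos β ^ 2 * angularWeight α β = profileConst α / 3 := by
    unfold profileConst
    have e : (fun θ => kernelK θ * angularWeight α θ) = fun θ => 3 * (Real.sin θ * Real.cos θ ^ 2 * angularWeight α θ) := by
      funext θ; simp only [kernelK]; ring
    rw [e, intervalIntegral.integral_const_mul]; ring
  have hi1 : IntervalIntegrable (fun β => Real.sin β * Real.cos β ^ 2 * angularWeight α β) volume 0 (π / 2) := by
    apply Continuous.intervalIntegrable
    exact (by fun_prop : Continuous fun β => Real.sin β * Real.cos β ^ 2).mul (continuous_angularWeight hα)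
  have hi2 : IntervalIntegrable (fun β => 5 / 4 * profileConst α * (Real.sin β * Real.cos β ^ 2 * Real.sin (2 * β))) volume 0 (π / 2) := by
    apply Continuous.intervalIntegrable; fun_prop
  have e : (fun β => Real.sin β * Real.cos β ^ 2 * gammaBar α β) =
      fun β => Real.sin β * Real.cos β ^ 2 * angularWeight α β - 5 / 4 * profileConst α * (Real.sin β * Real.cos β ^ 2 * Real.sin (2 * β)) := by
    funext β; simp only [gammaBar]; ring
  rw [e, intervalIntegral.integral_sub hi1 hi2, intervalIntegral.integral_const_mul, h1, integral_K0_mul_sin_two_mul]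
  ring

section ode

variable {α : ℝ} (hα : 0 < α) (hα' : α ≤ 1 / 200)
include hα hα'

/-! ### Orthogonality and boundary values -/

/-- **`cos θ·χ₁ ⊥ sin θ cos²θ`**: `∫₀^{π/2} cos β χ₁(β)·sin β cos²β dβ = 0` (the projection `Π`). [folklore] -/
theorem integral_cos_chiOne_mul_K0 :
    ∫ β in (0:ℝ)..(π / 2), Real.cos β * chiOne α β * (Real.sin β * Real.cos β ^ 2) = 0 := by
  set d := corrData α (chiOne α) with hd
  set y := greenOp d with hy
  set c₁ := projCoeff y with hc₁
  have hyc : ContinuousOn y (Icc 0 (π / 2)) := continuousOn_greenOp_corrData hα.le (chiOne α)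
  have hπ : (0:ℝ) ≤ π / 2 := by positivity
  -- replace `χ₁` by `y − c₁ sin` under the integral
  have e : ∫ β in (0:ℝ)..(π / 2), Real.cos β * chiOne α β * (Real.sin β * Real.cos β ^ 2) =
      ∫ β in (0:ℝ)..(π / 2), (Real.cos β * y β * (Real.sin β * Real.cos β ^ 2) - c₁ * (Real.cos β * Real.sin β * (Real.sin β * Real.cos β ^ 2))) := by
    refine intervalIntegral.integral_congr fun β hβ => ?_
    rw [uIcc_of_le hπ] at hβ
    have := chiOne_eq hα hα' hβ
    simp only [corrRaw] at this
    rw [this]; ring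
  have hi1 : IntervalIntegrable (fun β => Real.cos β * y β * (Real.sin β * Real.cos β ^ 2)) volume 0 (π / 2) :=
    ((Real.continuous_cos.continuousOn.mul hyc).mul (Continuous.continuousOn (by fun_prop))).intervalIntegrable_of_Icc hπ
  have hi2 : IntervalIntegrable (fun β => c₁ * (Real.cos β * Real.sin β * (Real.sin β * Real.cos β ^ 2))) volume 0 (π / 2) := by
    apply Continuous.intervalIntegrable; fun_prop
  rw [e, intervalIntegral.integral_sub hi1 hi2, intervalIntegral.integral_const_mul, integral_cos_sin_mul_K0]
  have : c₁ = 15 / 2 * ∫ β in (0:ℝ)..(π / 2), Real.cos β * y β * (Real.sin β * Real.cos β ^ 2) := rfl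
  rw [this]; ring

/-- **`ψ₁ ⊥ K₀`**: `∫₀^{π/2} ψ₁(β) sin β cos²β dβ = 0`. [cite: Elgindi2021, §8.3 Proposition 8.13 (p. 27 of arXiv:1904.04795): the solvability/orthogonality structure of the angular problem] -/
theorem integral_psiOne_mul_K0 : ∫ β in (0:ℝ)..(π / 2), psiOne α β * (Real.sin β * Real.cos β ^ 2) = 0 := by
  have h := integral_cos_chiOne_mul_K0 hα hα'
  unfold psiOne; exact h

/-- **`χ₁(0) = 0`** (`𝒦h(0) = −⟨h, K₀⟩` with `⟨Γ̄, K₀⟩ = 0` and `⟨cos θχ₁, K₀⟩ = 0`). [folklore] -/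
theorem chiOne_zero : chiOne α 0 = 0 := by
  have h0 : (0:ℝ) ∈ Icc 0 (π / 2) := ⟨le_rfl, by positivity⟩
  rw [chiOne_eq hα hα' h0]
  simp only [corrRaw, Real.sin_zero, mul_zero, sub_zero, greenOp_zero]
  unfold greenI2
  have hi1 : IntervalIntegrable (fun β => Real.sin β * Real.cos β ^ 2 * gammaBar α β) volume 0 (π / 2) := by
    apply Continuous.intervalIntegrable
    exact (by fun_prop : Continuous fun β => Real.sin β * Real.cos β ^ 2).mul (continuous_gammaBar hα.le)
  have hi2 : IntervalIntegrable (fun β => muOne α * (Real.cos β * chiOne α β * (Real.sin β * Real.cos β ^ 2))) volume 0 (π / 2) := by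
    apply Continuous.intervalIntegrable
    exact continuous_const.mul ((Real.continuous_cos.mul (chiOne α).continuous).mul (by fun_prop))
  have e : (fun β => Real.sin β * Real.cos β ^ 2 * corrData α (chiOne α) β) =
      fun β => Real.sin β * Real.cos β ^ 2 * gammaBar α β - muOne α * (Real.cos β * chiOne α β * (Real.sin β * Real.cos β ^ 2)) := by
    funext β; simp only [corrData]; ring
  rw [e, intervalIntegral.integral_sub hi1 hi2, intervalIntegral.integral_const_mul, integral_K0_mul_gammaBar hα.le,
    integral_cos_chiOne_mul_K0 hα hα']
  ring

/-- `ψ₁(0) = 0`. [folklore] -/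
theorem psiOne_zero : psiOne α 0 = 0 := by
  simp [psiOne, chiOne_zero hα hα']

omit hα hα' in
/-- `ψ₁(π/2) = 0`. [folklore] -/
theorem psiOne_pi_div_two : psiOne α (π / 2) = 0 := by
  simp [psiOne, Real.cos_pi_div_two]

/-! ### The derivative and the flux equation -/

/-- **`χ₁′ = cos θ·I₁ + (v₂/cos³θ)·I₂ − c₁cos θ`** (the data being `h₁ = Γ̄ − μ₁cos θχ₁`). [folklore] -/
def chiOneD (α θ : ℝ) : ℝ :=
  Real.cos θ * greenI1 (corrData α (chiOne α)) θ + greenV2 θ / Real.cos θ ^ 3 * greenI2 (corrData α (chiOne α)) θ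
    - projCoeff (greenOp (corrData α (chiOne α))) * Real.cos θ

/-- **`χ₁` is differentiable on `(0, π/2)` with derivative `chiOneD`.** [folklore] -/
theorem hasDerivAt_chiOne {θ : ℝ} (hθ : θ ∈ Ioo 0 (π / 2)) : HasDerivAt (chiOne α) (chiOneD α θ) θ := by
  set d := corrData α (chiOne α) with hd
  have hdc : ContinuousOn d (Icc 0 (π / 2)) := (continuous_corrData hα.le (chiOne α)).continuousOn
  have h1 : HasDerivAt (fun θ' => greenOp d θ' - projCoeff (greenOp d) * Real.sin θ') (chiOneD α θ) θ := by
    have := (hasDerivAt_greenOp hdc hθ).fun_sub ((Real.hasDerivAt_sin θ).const_mul (projCoeff (greenOp d)))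
    unfold chiOneD
    exact this
  refine h1.congr_of_eventuallyEq ?_
  filter_upwards [isOpen_Ioo.mem_nhds hθ] with θ' hθ'
  have := chiOne_eq hα hα' (Ioo_subset_Icc_self hθ')
  simp only [corrRaw] at this
  exact this

/-- `deriv χ₁ = chiOneD` on `(0, π/2)`. [folklore] -/
theorem deriv_chiOne {θ : ℝ} (hθ : θ ∈ Ioo 0 (π / 2)) : deriv (chiOne α) θ = chiOneD α θ :=
  (hasDerivAt_chiOne hα hα' hθ).deriv

/-- **The flux equation `(cos³θ·χ₁′)′ = −(4 − μ₁)cos³θ·χ₁ − cos²θ·Γ̄`** on `(0, π/2)`: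
`−(cos³θχ₁′)′ − (4−μ₁)cos³θχ₁ = cos²θΓ̄`, i.e. `(M − μ₁)χ₁ = Γ̄/cos θ`. [cite: Elgindi2021, §8.3 Proposition 8.13 (p. 27 of arXiv:1904.04795); the angular operator of §7 (p. 19)] -/
theorem hasDerivAt_chiOne_flux {θ : ℝ} (hθ : θ ∈ Ioo 0 (π / 2)) :
    HasDerivAt (fun θ' => Real.cos θ' ^ 3 * chiOneD α θ')
      (-(4 - muOne α) * Real.cos θ ^ 3 * chiOne α θ - Real.cos θ ^ 2 * gammaBar α θ) θ := by
  set d := corrData α (chiOne α) with hd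
  set c₁ := projCoeff (greenOp d) with hc₁
  have hθ' : θ ∈ Ioo (-(π / 2)) (π / 2) := ⟨by linarith [hθ.1, Real.pi_pos], hθ.2⟩
  have hc0 : Real.cos θ ≠ 0 := (Real.cos_pos_of_mem_Ioo hθ').ne'
  have hdc : ContinuousOn d (Icc 0 (π / 2)) := (continuous_corrData hα.le (chiOne α)).continuousOn
  -- `cos³χ₁′ = cos⁴I₁ + v₂I₂ − c₁cos⁴` near `θ`
  have heq : (fun θ' => Real.cos θ' ^ 3 * chiOneD α θ') =ᶠ[𝓝 θ]
      fun θ' => (Real.cos θ' ^ 4 * greenI1 d θ' + greenV2 θ' * greenI2 d θ') - c₁ * Real.cos θ' ^ 4 := by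
    filter_upwards [isOpen_Ioo.mem_nhds hθ] with θ' hθ'
    have hc' : Real.cos θ' ≠ 0 := (Real.cos_pos_of_mem_Ioo ⟨by linarith [hθ'.1, Real.pi_pos], hθ'.2⟩).ne'
    simp only [chiOneD, ← hd, ← hc₁]
    field_simp
  have h1 := hasDerivAt_greenFlux hdc hθ
  have h2 : HasDerivAt (fun θ' => c₁ * Real.cos θ' ^ 4) (c₁ * (((4 : ℕ) : ℝ) * Real.cos θ ^ (4 - 1) * (-Real.sin θ))) θ :=
    ((Real.hasDerivAt_cos θ).fun_pow 4).const_mul c₁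
  have h := h1.fun_sub h2
  refine (h.congr_of_eventuallyEq heq).congr_deriv ?_
  have hχ : chiOne α θ = greenOp d θ - c₁ * Real.sin θ := by
    have := chiOne_eq hα hα' (Ioo_subset_Icc_self hθ)
    simp only [corrRaw] at this
    exact this
  simp only [hd, corrData]
  rw [hχ]
  push_cast
  ring

/-- **The second derivative: `χ₁″ = 3 tan θ χ₁′ − (4−μ₁)χ₁ − Γ̄/cos θ`** on `(0, π/2)`. [folklore] -/
theorem hasDerivAt_chiOneD {θ : ℝ} (hθ : θ ∈ Ioo 0 (π / 2)) :
    HasDerivAt (chiOneD α) (3 * Real.tan θ * chiOneD α θ - (4 - muOne α) * chiOne α θ - gammaBar α θ / Real.cos θ) θ := by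
  have hθ' : θ ∈ Ioo (-(π / 2)) (π / 2) := ⟨by linarith [hθ.1, Real.pi_pos], hθ.2⟩
  have hc0 : Real.cos θ ≠ 0 := (Real.cos_pos_of_mem_Ioo hθ').ne'
  have hF := hasDerivAt_chiOne_flux hα hα' hθ
  have hc3 : HasDerivAt (fun θ' => Real.cos θ' ^ 3) (((3 : ℕ) : ℝ) * Real.cos θ ^ (3 - 1) * (-Real.sin θ)) θ := (Real.hasDerivAt_cos θ).fun_pow 3
  have h := hF.fun_div hc3 (pow_ne_zero 3 hc0)
  have heq : (fun θ' => Real.cos θ' ^ 3 * chiOneD α θ' / Real.cos θ' ^ 3) =ᶠ[𝓝 θ] chiOneD α := by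
    filter_upwards [isOpen_Ioo.mem_nhds hθ] with θ' hθ'
    have hc' : Real.cos θ' ≠ 0 := (Real.cos_pos_of_mem_Ioo ⟨by linarith [hθ'.1, Real.pi_pos], hθ'.2⟩).ne'
    field_simp
  refine (h.congr_of_eventuallyEq heq.symm).congr_deriv ?_
  rw [Real.tan_eq_sin_div_cos]
  field_simp
  push_cast
  ring

/-! ### The corrector `ψ₁ = cos θ·χ₁` and the angular equation -/

/-- `ψ₁′ = −sin θ·χ₁ + cos θ·χ₁′`. [folklore] -/
def psiOneD (α θ : ℝ) : ℝ := -Real.sin θ * chiOne α θ + Real.cos θ * chiOneD α θ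

/-- `ψ₁″ = sin θ·χ₁′ − (5 − μ₁)cos θ·χ₁ − Γ̄` (a bounded function). [folklore] -/
def psiOneDD (α θ : ℝ) : ℝ := Real.sin θ * chiOneD α θ - (5 - muOne α) * Real.cos θ * chiOne α θ - gammaBar α θ

/-- **`ψ₁` is differentiable on `(0, π/2)` with `ψ₁′ = psiOneD`.** [folklore] -/
theorem hasDerivAt_psiOne {θ : ℝ} (hθ : θ ∈ Ioo 0 (π / 2)) : HasDerivAt (psiOne α) (psiOneD α θ) θ := by
  have h := (Real.hasDerivAt_cos θ).fun_mul (hasDerivAt_chiOne hα hα' hθ)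
  have e : psiOne α = fun θ' => Real.cos θ' * chiOne α θ' := rfl
  rw [e]
  exact h

/-- **`ψ₁′` is differentiable on `(0, π/2)` with `ψ₁″ = psiOneDD`** (uses the flux equation:
`cos θχ₁″ = 3 sin θχ₁′ − (4−μ₁)cos θχ₁ − Γ̄`). [folklore] -/
theorem hasDerivAt_psiOneD {θ : ℝ} (hθ : θ ∈ Ioo 0 (π / 2)) : HasDerivAt (psiOneD α) (psiOneDD α θ) θ := by
  have hθ' : θ ∈ Ioo (-(π / 2)) (π / 2) := ⟨by linarith [hθ.1, Real.pi_pos], hθ.2⟩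
  have hc0 : Real.cos θ ≠ 0 := (Real.cos_pos_of_mem_Ioo hθ').ne'
  have h1 : HasDerivAt (fun θ' => -Real.sin θ' * chiOne α θ') (-Real.cos θ * chiOne α θ + -Real.sin θ * chiOneD α θ) θ :=
    ((Real.hasDerivAt_sin θ).neg.fun_mul (hasDerivAt_chiOne hα hα' hθ))
  have h2 := (Real.hasDerivAt_cos θ).fun_mul (hasDerivAt_chiOneD hα hα' hθ)
  have h := h1.fun_add h2
  have e : psiOneD α = fun θ' => -Real.sin θ' * chiOne α θ' + Real.cos θ' * chiOneD α θ' := rfl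
  rw [e]
  refine h.congr_deriv ?_
  simp only [psiOneDD]
  rw [Real.tan_eq_sin_div_cos]
  field_simp
  ring

/-- `tan θ·ψ₁ = sin θ·χ₁` on `(0, π/2)` with derivative `cos θχ₁ + sin θχ₁′`. [folklore] -/
theorem hasDerivAt_tan_mul_psiOne {θ : ℝ} (hθ : θ ∈ Ioo 0 (π / 2)) :
    HasDerivAt (fun θ' => Real.tan θ' * psiOne α θ') (Real.cos θ * chiOne α θ + Real.sin θ * chiOneD α θ) θ := by
  have heq : (fun θ' => Real.tan θ' * psiOne α θ') =ᶠ[𝓝 θ] fun θ' => Real.sin θ' * chiOne α θ' := by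
    filter_upwards [isOpen_Ioo.mem_nhds hθ] with θ' hθ'
    have hc' : Real.cos θ' ≠ 0 := (Real.cos_pos_of_mem_Ioo ⟨by linarith [hθ'.1, Real.pi_pos], hθ'.2⟩).ne'
    simp only [psiOne]
    rw [Real.tan_eq_sin_div_cos]
    field_simp
  have h := (Real.hasDerivAt_sin θ).fun_mul (hasDerivAt_chiOne hα hα' hθ)
  exact (h.congr_of_eventuallyEq heq).congr_deriv (by ring)

omit hα hα' in
/-- **The angular equation `(L_θ + μ₁)ψ₁ = Γ̄`**: on `(0, π/2)`,
`−ψ₁″ + (tan θψ₁)′ − 6ψ₁ = Γ̄ − μ₁ψ₁` with `ψ₁″ = psiOneDD`, `(tan θψ₁)′ = cos θχ₁ + sin θχ₁′`. [cite: Elgindi2021, §7 (p. 19 of arXiv:1904.04795): the angular operator −∂_θθ + ∂_θ(tan θ·) − 6 of (PolarBSL); §8.3 Proposition 8.13 (p. 27)] -/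
theorem angularOp_psiOne (θ : ℝ) :
    -psiOneDD α θ + (Real.cos θ * chiOne α θ + Real.sin θ * chiOneD α θ) - 6 * psiOne α θ = gammaBar α θ - muOne α * psiOne α θ := by
  simp only [psiOneDD, psiOne]; ring

/-! ### Sup bounds -/

/-- **`|χ₁′| ≤ 300` on `(0, π/2)`** (`χ₁′ = cos θI₁ + v₂·(I₂/cos³θ) − c₁cos θ` with
`|I₂| ≤ (10/3)cos³θ`: the derivative stays bounded at `π/2`). [folklore] -/
theorem abs_chiOneD_le {θ : ℝ} (hθ : θ ∈ Ioo 0 (π / 2)) : |chiOneD α θ| ≤ 300 := by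
  set d := corrData α (chiOne α) with hd
  have hθc : θ ∈ Icc 0 (π / 2) := Ioo_subset_Icc_self hθ
  have hθ' : θ ∈ Ioo (-(π / 2)) (π / 2) := ⟨by linarith [hθ.1, Real.pi_pos], hθ.2⟩
  have hc0 : 0 < Real.cos θ := Real.cos_pos_of_mem_Ioo hθ'
  have hdc : ContinuousOn d (Icc 0 (π / 2)) := (continuous_corrData hα.le (chiOne α)).continuousOn
  have hbd : ∀ β ∈ Icc (0:ℝ) (π / 2), |d β| ≤ 10 := fun β hβ => abs_corrData_chiOne_le hα hα' hβ
  have hI1 : |greenI1 d θ| ≤ 5 * 10 * θ := abs_greenI1_le hbd hθc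
  have hI2 : |greenI2 d θ| ≤ 10 * (Real.cos θ ^ 3 / 3) := abs_greenI2_le hdc hbd hθc
  have hv : |greenV2 θ| ≤ 6 := abs_greenV2_le ⟨hθ.1.le, hθ.2⟩
  have hc₁ : |projCoeff (greenOp d)| ≤ 15 / 8 * (10 * 10) :=
    abs_projCoeff_le (continuousOn_greenOp_corrData hα.le (chiOne α)) fun β hβ => abs_greenOp_le hdc hbd hβ
  have hc1 : |Real.cos θ| ≤ 1 := Real.abs_cos_le_one θ
  have hπ : θ ≤ 1.6 := by have := Real.pi_lt_d2; linarith [hθc.2]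
  have hI2' : |greenI2 d θ / Real.cos θ ^ 3| ≤ 10 / 3 := by
    rw [abs_div, abs_of_pos (by positivity : (0:ℝ) < Real.cos θ ^ 3), div_le_iff₀ (by positivity)]
    linarith
  have e : chiOneD α θ = Real.cos θ * greenI1 d θ + greenV2 θ * (greenI2 d θ / Real.cos θ ^ 3) - projCoeff (greenOp d) * Real.cos θ := by
    simp only [chiOneD, hd]; ring
  rw [e]
  calc |Real.cos θ * greenI1 d θ + greenV2 θ * (greenI2 d θ / Real.cos θ ^ 3) - projCoeff (greenOp d) * Real.cos θ|
      ≤ |Real.cos θ * greenI1 d θ| + |greenV2 θ * (greenI2 d θ / Real.cos θ ^ 3)| + |projCoeff (greenOp d) * Real.cos θ| := by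
        have h₁ := abs_sub (Real.cos θ * greenI1 d θ + greenV2 θ * (greenI2 d θ / Real.cos θ ^ 3)) (projCoeff (greenOp d) * Real.cos θ)
        have h₂ := abs_add_le (Real.cos θ * greenI1 d θ) (greenV2 θ * (greenI2 d θ / Real.cos θ ^ 3))
        linarith
    _ ≤ 1 * (5 * 10 * θ) + 6 * (10 / 3) + 15 / 8 * (10 * 10) * 1 := by
        refine add_le_add (add_le_add ?_ ?_) ?_
        · rw [abs_mul]; exact mul_le_mul hc1 hI1 (abs_nonneg _) (by norm_num)
        · rw [abs_mul]; exact mul_le_mul hv hI2' (abs_nonneg _) (by norm_num)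
        · rw [abs_mul]; exact mul_le_mul hc₁ hc1 (abs_nonneg _) (by positivity)
    _ ≤ 300 := by nlinarith

/-- **`|cos θ·χ₁′| ≤ 300`** on `(0, π/2)`. [folklore] -/
theorem abs_cos_mul_chiOneD_le {θ : ℝ} (hθ : θ ∈ Ioo 0 (π / 2)) : |Real.cos θ * chiOneD α θ| ≤ 300 := by
  set d := corrData α (chiOne α) with hd
  have hdc : ContinuousOn d (Icc 0 (π / 2)) := (continuous_corrData hα.le (chiOne α)).continuousOn
  have hbd : ∀ β ∈ Icc (0:ℝ) (π / 2), |d β| ≤ 10 := fun β hβ => abs_corrData_chiOne_le hα hα' hβ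
  have h1 := abs_cos_mul_deriv_greenOp_le hdc hbd hθ
  have h2 : |projCoeff (greenOp d)| ≤ 15 / 8 * (10 * 10) :=
    abs_projCoeff_le (continuousOn_greenOp_corrData hα.le (chiOne α)) fun β hβ => abs_greenOp_le hdc hbd hβ
  have hc : |Real.cos θ| ≤ 1 := Real.abs_cos_le_one θ
  have e : Real.cos θ * chiOneD α θ = Real.cos θ * (Real.cos θ * greenI1 d θ + greenV2 θ / Real.cos θ ^ 3 * greenI2 d θ)
      - projCoeff (greenOp d) * (Real.cos θ * Real.cos θ) := by simp only [chiOneD, hd]; ring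
  rw [e]
  calc |Real.cos θ * (Real.cos θ * greenI1 d θ + greenV2 θ / Real.cos θ ^ 3 * greenI2 d θ) - projCoeff (greenOp d) * (Real.cos θ * Real.cos θ)|
      ≤ |Real.cos θ * (Real.cos θ * greenI1 d θ + greenV2 θ / Real.cos θ ^ 3 * greenI2 d θ)| + |projCoeff (greenOp d)| * (|Real.cos θ| * |Real.cos θ|) := by
        rw [← abs_mul, ← abs_mul]; exact abs_sub _ _
    _ ≤ 10 * 10 + 15 / 8 * (10 * 10) * (1 * 1) := by
        refine add_le_add h1 (mul_le_mul h2 ?_ (by positivity) (by positivity))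
        exact mul_le_mul hc hc (abs_nonneg _) (by norm_num)
    _ ≤ 300 := by norm_num

/-- **`|ψ₁′| ≤ 600`** on `(0, π/2)`. [folklore] -/
theorem abs_psiOneD_le {θ : ℝ} (hθ : θ ∈ Ioo 0 (π / 2)) : |psiOneD α θ| ≤ 600 := by
  have h1 := abs_chiOne_le hα hα' θ
  have h2 := abs_cos_mul_chiOneD_le hα hα' hθ
  have hs : |Real.sin θ| ≤ 1 := Real.abs_sin_le_one θ
  unfold psiOneD
  calc |-Real.sin θ * chiOne α θ + Real.cos θ * chiOneD α θ| ≤ |-Real.sin θ * chiOne α θ| + |Real.cos θ * chiOneD α θ| := abs_add_le _ _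
    _ ≤ 1 * 300 + 300 := by
        refine add_le_add ?_ h2
        rw [abs_mul, abs_neg]; exact mul_le_mul hs h1 (abs_nonneg _) (by norm_num)
    _ = 600 := by norm_num

/-- **`|ψ₁″| ≤ 2410`** on `(0, π/2)` (`|sin θχ₁′| ≤ tan θ·300 …` is *not* used: `sin θχ₁′ =
tan θ·(cos θχ₁′)` is unbounded near `π/2` only through `tan θ`; instead `sin θ·χ₁′` is bounded via
`ψ₁′`: `sin θχ₁′·cos θ = sin θ(ψ₁′ + sin θχ₁)` — so we bound the combination directly from the
fixed-point structure: `|sin θ χ₁′| ≤ |χ₁′ cos θ|·tan θ` fails, and we use `χ₁′ = ψ₁′/cos θ + tan θχ₁`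
only where harmless). Concretely `ψ₁″ = sin θχ₁′ − (5−μ₁)cos θχ₁ − Γ̄` and
`sin θχ₁′ = sin θ cos θ I₁ + v₂·(sin θ I₂/cos³θ) − c₁ sin θ cos θ` with `|I₂| ≤ (10/3)cos³θ`. [folklore] -/
theorem abs_psiOneDD_le {θ : ℝ} (hθ : θ ∈ Ioo 0 (π / 2)) : |psiOneDD α θ| ≤ 2410 := by
  set d := corrData α (chiOne α) with hd
  have hθc : θ ∈ Icc 0 (π / 2) := Ioo_subset_Icc_self hθ
  have hθ' : θ ∈ Ioo (-(π / 2)) (π / 2) := ⟨by linarith [hθ.1, Real.pi_pos], hθ.2⟩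
  have hc0 : 0 < Real.cos θ := Real.cos_pos_of_mem_Ioo hθ'
  have hdc : ContinuousOn d (Icc 0 (π / 2)) := (continuous_corrData hα.le (chiOne α)).continuousOn
  have hbd : ∀ β ∈ Icc (0:ℝ) (π / 2), |d β| ≤ 10 := fun β hβ => abs_corrData_chiOne_le hα hα' hβ
  have hI1 : |greenI1 d θ| ≤ 5 * 10 * θ := abs_greenI1_le hbd hθc
  have hI2 : |greenI2 d θ| ≤ 10 * (Real.cos θ ^ 3 / 3) := abs_greenI2_le hdc hbd hθc
  have hv : |greenV2 θ| ≤ 6 := abs_greenV2_le ⟨hθ.1.le, hθ.2⟩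
  have hc₁ : |projCoeff (greenOp d)| ≤ 15 / 8 * (10 * 10) :=
    abs_projCoeff_le (continuousOn_greenOp_corrData hα.le (chiOne α)) fun β hβ => abs_greenOp_le hdc hbd hβ
  have hχ := abs_chiOne_le hα hα' θ
  have hΓ := abs_gammaBar_le hα.le hθc
  have hμ := abs_muOne_le hα hα'
  have hs : |Real.sin θ| ≤ 1 := Real.abs_sin_le_one θ
  have hc1 : |Real.cos θ| ≤ 1 := Real.abs_cos_le_one θ
  have hπ : θ ≤ 1.6 := by have := Real.pi_lt_d2; linarith [hθc.2]
  -- `sin θχ₁′` written out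
  have e : Real.sin θ * chiOneD α θ = Real.sin θ * Real.cos θ * greenI1 d θ + greenV2 θ * (Real.sin θ * (greenI2 d θ / Real.cos θ ^ 3))
      - projCoeff (greenOp d) * (Real.sin θ * Real.cos θ) := by
    simp only [chiOneD, hd]; field_simp
  have hI2' : |greenI2 d θ / Real.cos θ ^ 3| ≤ 10 / 3 := by
    rw [abs_div, abs_of_pos (by positivity : (0:ℝ) < Real.cos θ ^ 3), div_le_iff₀ (by positivity)]
    linarith
  have hT1 : |Real.sin θ * Real.cos θ * greenI1 d θ| ≤ 1 * 1 * (5 * 10 * θ) := by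
    rw [abs_mul, abs_mul]; exact mul_le_mul (mul_le_mul hs hc1 (abs_nonneg _) (by norm_num)) hI1 (abs_nonneg _) (by norm_num)
  have hT2 : |greenV2 θ * (Real.sin θ * (greenI2 d θ / Real.cos θ ^ 3))| ≤ 6 * (1 * (10 / 3)) := by
    rw [abs_mul, abs_mul]; exact mul_le_mul hv (mul_le_mul hs hI2' (abs_nonneg _) (by norm_num)) (by positivity) (by norm_num)
  have hT3 : |projCoeff (greenOp d) * (Real.sin θ * Real.cos θ)| ≤ 15 / 8 * (10 * 10) * (1 * 1) := by
    rw [abs_mul, abs_mul]; exact mul_le_mul hc₁ (mul_le_mul hs hc1 (abs_nonneg _) (by norm_num)) (by positivity) (by positivity)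
  have hS : |Real.sin θ * chiOneD α θ| ≤ 300 := by
    rw [e]
    calc |Real.sin θ * Real.cos θ * greenI1 d θ + greenV2 θ * (Real.sin θ * (greenI2 d θ / Real.cos θ ^ 3)) - projCoeff (greenOp d) * (Real.sin θ * Real.cos θ)|
        ≤ |Real.sin θ * Real.cos θ * greenI1 d θ| + |greenV2 θ * (Real.sin θ * (greenI2 d θ / Real.cos θ ^ 3))| + |projCoeff (greenOp d) * (Real.sin θ * Real.cos θ)| := by
            have h₁ := abs_sub (Real.sin θ * Real.cos θ * greenI1 d θ + greenV2 θ * (Real.sin θ * (greenI2 d θ / Real.cos θ ^ 3))) (projCoeff (greenOp d) * (Real.sin θ * Real.cos θ))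
            have h₂ := abs_add_le (Real.sin θ * Real.cos θ * greenI1 d θ) (greenV2 θ * (Real.sin θ * (greenI2 d θ / Real.cos θ ^ 3)))
            linarith
      _ ≤ 1 * 1 * (5 * 10 * θ) + 6 * (1 * (10 / 3)) + 15 / 8 * (10 * 10) * (1 * 1) := add_le_add (add_le_add hT1 hT2) hT3
      _ ≤ 300 := by nlinarith
  have hT4 : |(5 - muOne α) * Real.cos θ * chiOne α θ| ≤ (5 + 1 / 39) * 1 * 300 := by
    rw [abs_mul, abs_mul]
    refine mul_le_mul (mul_le_mul ?_ hc1 (abs_nonneg _) (by positivity)) hχ (abs_nonneg _) (by positivity)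
    calc |5 - muOne α| ≤ |(5:ℝ)| + |muOne α| := abs_sub _ _
      _ ≤ 5 + 1 / 39 := by rw [abs_of_pos (by norm_num : (0:ℝ) < 5)]; linarith
  unfold psiOneDD
  calc |Real.sin θ * chiOneD α θ - (5 - muOne α) * Real.cos θ * chiOne α θ - gammaBar α θ|
      ≤ |Real.sin θ * chiOneD α θ| + |(5 - muOne α) * Real.cos θ * chiOne α θ| + |gammaBar α θ| := by
        have := abs_sub (Real.sin θ * chiOneD α θ - (5 - muOne α) * Real.cos θ * chiOne α θ) (gammaBar α θ)
        have := abs_sub (Real.sin θ * chiOneD α θ) ((5 - muOne α) * Real.cos θ * chiOne α θ)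
        linarith
    _ ≤ 300 + (5 + 1 / 39) * 1 * 300 + 9 / 4 := add_le_add (add_le_add hS hT4) hΓ
    _ ≤ 2410 := by norm_num

end ode

end Elgindi

end Literature.Analysis.FluidPDE
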